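import Summits.BirchSwinnertonDyer.BirchSwinnertonDyer.Theorems.GoldfeldAllTwistsTwoConverseTwinGenusHeightTransport
import Summits.BirchSwinnertonDyer.BirchSwinnertonDyer.Theorems.GoldfeldAllTwistsTwoConverseTwinGenusDescentPartnerNegTwo
import HarnessLib

set_option linter.dupNamespace false
set_option autoImplicit false

/-!
# LINE B49, genus assembly, family F2 (`d_K = −8q`): the HEIGHT TRANSPORT (row C7′) —
# `ĥ_F((−2, y)) = [F : ℚ] · ĥ_ℚ(g₃₁₃₆)` for the points `(−2, y)` of `X₀(49)` over any number field `F ∋ √−2`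
# and the generator `g₃₁₃₆ = (32, 64)` of the F2 partner `W₃₁₃₆ = [0, −42, 0, 448, 0] = 49a1^{(−2)}`

Cell `bsd-goldfeld`, seat `bsd-goldfeld-s1p-c3` (prover, gen 8); memo `HOME/B49-GENUS.md` §1 (family F2: `D = −8q`,
`q ≡ 1 (mod 4)`, genus field `H₀ = K(√q) = K(√−2)`, partner `E₋₂`, `x(g′) = −2`), the F2 analogue of row C7 of
`HOME/GENUS-THEOREM-A.md` (file `…TwinGenusHeightTransport`, family F1). Support for item `stmt-BirchSwinnertonDyer-19140`
(crux twin″; joint with 20044 K12₂″). Theorems only. HONEST FRAMING: elementary bookkeeping about explicit Weierstrass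
models and Néron–Tate heights; nothing about `L`-values, Theorem A or BSD is asserted here.

THE POINT. On `X₀(49) : y² + xy = x³ − x² − 2x − 1` the points with `x = −2` satisfy `y² − 2y + 9 = 0`, i.e.
`(y − 1)² = −8`, `y = 1 ± 2√−2`: they live over the genus field `ℚ(√−2) ⊂ K(√−2) = H₀` of family F2 and play the
role the points `(0, ±i)` play for family F1. Under the substitution `x = u²x' + 2`, `y = u³y' − u²x'/2 − 1` with
`u = (y − 1)⁻¹` (`u² = −1/8`) the equation becomes seat c301's `W₃₁₃₆ : y'² = x'³ − 42x'² + 448x'`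
(`smul_cm7_baseChange_eq_W3136`) and `(−2, y) ↦ (32, 64) = g₃₁₃₆` (`pointEquiv_negTwo_cm7`:
`x' = u⁻²(−4) = 32`, `y' = u⁻³·(y − 1) = (y − 1)⁴ = 64`).

CONTENTS. §1 the isomorphism; §2 **row C7′**: `canonicalHeight_negTwo_cm7_eq` — `ĥ_F((−2, y)) = [F : ℚ]·ĥ_ℚ(g₃₁₃₆)`
(`canonicalHeight_pointEquiv`, `canonicalHeight_baseChange`), and `canonicalHeight_negTwo_cm7_ne_zero` (seat c301's
`not_isOfFinAddOrder_threeTwoSixFour_W3136`).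

References: J. H. Silverman, AEC (2009) III.1 Table 3.1, Prop. VIII.9.1, Prop. VIII.5.4(b) [SilvermanAEC2009];
B. Gross, in *Modular forms* (1984) §§4–5 [Gross1984].
-/

noncomputable section

open scoped Classical

open WeierstrassCurve Literature.NumberTheory.EllipticCurves
  Literature.NumberTheory.EllipticCurves.ModularForms

namespace Summit.BirchSwinnertonDyer.BirchSwinnertonDyer.Theorems.GoldfeldGoodTwists

/-! ## §1 The explicit isomorphism `X₀(49) ≅ W₃₁₃₆` over a field containing `√−2` -/

section Iso

variable {F : Type*} [Field F] [CharZero F] {y : F}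

/-- A point `(−2, y)` of `X₀(49)` has `(y − 1)² = −8` (the equation `y² + xy = x³ − x² − 2x − 1` at `x = −2`).
[folklore] -/
theorem sq_sub_one_eq_neg_eight_of_nonsingular_negTwo (hg : (cm7.baseChange F).toAffine.Nonsingular (-2) y) :
    (y - 1) ^ 2 = -8 := by
  have h := (Affine.equation_iff (-2 : F) y).mp hg.1
  simp [baseChange] at h
  linear_combination h

/-- `y − 1 ≠ 0` when `(y − 1)² = −8`. [folklore] -/
theorem sub_one_ne_zero_of_sq (hy : (y - 1) ^ 2 = -8) : y - 1 ≠ 0 := by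
  intro h
  rw [h] at hy
  norm_num at hy

/-- **`((y−1)⁻¹, 2, −1/2, −1) • (X₀(49) ⊗ F) = W₃₁₃₆ ⊗ F`** for `(y − 1)² = −8`: the substitution `x = u²x' + 2`,
`y = u³y' − u²x'/2 − 1` with `u = (y − 1)⁻¹` (`u⁻² = −8`, `u⁻⁴ = 64`, `u⁻⁶ = −512`) takes `y² + xy = x³ − x² − 2x − 1` to
`y'² = x'³ − 42x'² + 448x'`. [cite: SilvermanAEC2009, III.1 Table 3.1] -/
theorem smul_cm7_baseChange_eq_W3136 (hy : (y - 1) ^ 2 = -8) :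
    (⟨Units.mk0 (y - 1)⁻¹ (inv_ne_zero (sub_one_ne_zero_of_sq hy)), 2, -1 / 2, -1⟩ : VariableChange F) •
        cm7.baseChange F =
      (⟨0, -42, 0, 448, 0⟩ : WeierstrassCurve ℚ).baseChange F := by
  have h0 : y - 1 ≠ 0 := sub_one_ne_zero_of_sq hy
  have hy4 : (y - 1) ^ 4 = 64 := by linear_combination ((y - 1) ^ 2 - 8) * hy
  have hy6 : (y - 1) ^ 6 = -512 := by linear_combination ((y - 1) ^ 4 - 8 * (y - 1) ^ 2 + 64) * hy
  ext
  · simp [baseChange, variableChange_a₁]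
    norm_num
  · simp [baseChange, variableChange_a₂]
    linear_combination (21 / 4 : F) * hy
  · simp [baseChange, variableChange_a₃]
  · simp [baseChange, variableChange_a₄]
    linear_combination (7 : F) * hy4
  · simp [baseChange, variableChange_a₆]
    norm_num

/-- `g₃₁₃₆ = (32, 64)` lies on `W₃₁₃₆ ⊗ F`. [folklore] -/
theorem nonsingular_W3136_baseChange_threeTwo_sixFour (F : Type*) [Field F] [CharZero F] :
    ((⟨0, -42, 0, 448, 0⟩ : WeierstrassCurve ℚ).baseChange F).toAffine.Nonsingular 32 64 := by
  haveI := isElliptic_twoTorsionModel_neg_two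
  haveI : ((⟨0, -42, 0, 448, 0⟩ : WeierstrassCurve ℚ).baseChange F).IsElliptic := by
    rw [WeierstrassCurve.baseChange]; infer_instance
  refine (Affine.equation_iff_nonsingular).mp ?_
  rw [Affine.equation_iff']
  simp [baseChange]
  norm_num

/-- **`(−2, y) ↦ (32, 64)`** under the substitution of `smul_cm7_baseChange_eq_W3136`:
`x' = u⁻²(−2 − 2) = (−8)(−4) = 32`, `y' = u⁻³(y − (−1/2)(−2 − 2) − (−1)) = (y − 1)³·(y − 1) = 64`.
[cite: SilvermanAEC2009, III.1 Table 3.1] -/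
theorem pointEquiv_negTwo_cm7 (hy : (y - 1) ^ 2 = -8) (hg : (cm7.baseChange F).toAffine.Nonsingular (-2) y) :
    VariableChange.pointEquiv (cm7.baseChange F)
        (⟨Units.mk0 (y - 1)⁻¹ (inv_ne_zero (sub_one_ne_zero_of_sq hy)), 2, -1 / 2, -1⟩ : VariableChange F)
        (Affine.Point.some (-2) y hg) =
      Affine.Point.some 32 64 ((smul_cm7_baseChange_eq_W3136 hy).symm ▸
        nonsingular_W3136_baseChange_threeTwo_sixFour F) := by
  have h0 : y - 1 ≠ 0 := sub_one_ne_zero_of_sq hy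
  have hy4 : (y - 1) ^ 4 = 64 := by linear_combination ((y - 1) ^ 2 - 8) * hy
  rw [VariableChange.pointEquiv_some]
  congr 1
  · simp only [VariableChange.toX_def, Units.val_inv_eq_inv_val, Units.val_mk0, inv_inv]
    linear_combination (-4 : F) * hy
  · simp only [VariableChange.toY_def, Units.val_inv_eq_inv_val, Units.val_mk0, inv_inv]
    linear_combination hy4

end Iso

/-! ## §2 Row C7′: `ĥ_F((−2, y)) = [F : ℚ] · ĥ_ℚ(g₃₁₃₆)` -/

section Height

variable {F : Type*} [Field F] [NumberField F] {y : F}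

/-- **Row C7′ of the F2 constant chain.** For a number field `F`, every point `(−2, y) ∈ X₀(49)(F)` (so
`(y − 1)² = −8`) has canonical height `ĥ_F((−2, y)) = [F : ℚ] · ĥ_ℚ(g₃₁₃₆)`, `g₃₁₃₆ = (32, 64) ∈ W₃₁₃₆(ℚ)`,
`W₃₁₃₆ = [0, −42, 0, 448, 0]` (heights RELATIVE to the field, tree `canonicalHeight`): `(−2, y)` is the image of
`g₃₁₃₆` under an `F`-isomorphism `W₃₁₃₆ ⊗ F ≅ X₀(49) ⊗ F` (§1; Silverman VIII.9.1 — tree `canonicalHeight_pointEquiv`),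
and `ĥ_F = [F : ℚ]·ĥ_ℚ` on `ℚ`-points (VIII.5.4(b) — tree `canonicalHeight_baseChange`).
[cite: SilvermanAEC2009, Prop. VIII.9.1 and Prop. VIII.5.4(b)] -/
theorem canonicalHeight_negTwo_cm7_eq (hg : (cm7.baseChange F).toAffine.Nonsingular (-2) y) :
    Affine.Point.canonicalHeight (Affine.Point.some (-2) y hg) =
      (Module.finrank ℚ F : ℝ) *
        Affine.Point.canonicalHeight (Affine.Point.some 32 64 nonsingular_W3136_threeTwo_sixFour :
          (⟨0, -42, 0, 448, 0⟩ : WeierstrassCurve ℚ).toAffine.Point) := by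
  haveI := isElliptic_twoTorsionModel_neg_two
  have hy : (y - 1) ^ 2 = -8 := sq_sub_one_eq_neg_eight_of_nonsingular_negTwo hg
  -- invariance under the change of variables, read on `W₃₁₃₆ ⊗ F`
  have h1 := Affine.Point.canonicalHeight_pointEquiv (W := cm7.baseChange F)
    (⟨Units.mk0 (y - 1)⁻¹ (inv_ne_zero (sub_one_ne_zero_of_sq hy)), 2, -1 / 2, -1⟩ : VariableChange F)
    (Affine.Point.some (-2) y hg)
  rw [pointEquiv_negTwo_cm7 hy hg, canonicalHeight_some_congr (smul_cm7_baseChange_eq_W3136 hy) _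
    (nonsingular_W3136_baseChange_threeTwo_sixFour F)] at h1
  rw [← h1]
  -- base change from `ℚ` to `F`
  have h2 := Affine.Point.canonicalHeight_baseChange (R := ℚ) (K := ℚ) (L := F)
    (W := (⟨0, -42, 0, 448, 0⟩ : WeierstrassCurve ℚ))
    (Affine.Point.some 32 64 nonsingular_W3136_threeTwo_sixFour)
  have h3 : Affine.Point.baseChange (W' := (⟨0, -42, 0, 448, 0⟩ : WeierstrassCurve ℚ)) ℚ F
        (Affine.Point.some 32 64 nonsingular_W3136_threeTwo_sixFour) =
      Affine.Point.some 32 64 (nonsingular_W3136_baseChange_threeTwo_sixFour F) := by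
    show Affine.Point.map (Algebra.ofId ℚ F) _ = _
    rw [Affine.Point.map_some]
    congr 1 <;> simp
  convert h2 using 2
  · exact h3.symm
  · rfl

/-- Hence `ĥ_F((−2, y)) ≠ 0`: `g₃₁₃₆` has infinite order (seat c301, `not_isOfFinAddOrder_threeTwoSixFour_W3136`) and
`ĥ = 0` exactly on torsion (Silverman VIII.9.3(d)). [cite: SilvermanAEC2009, Thm. VIII.9.3(d)] -/
theorem canonicalHeight_negTwo_cm7_ne_zero (hg : (cm7.baseChange F).toAffine.Nonsingular (-2) y) :
    Affine.Point.canonicalHeight (Affine.Point.some (-2) y hg) ≠ 0 := by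
  haveI := isElliptic_twoTorsionModel_neg_two
  rw [canonicalHeight_negTwo_cm7_eq hg]
  refine mul_ne_zero (by exact_mod_cast Module.finrank_pos.ne') fun h0 ↦ ?_
  exact not_isOfFinAddOrder_threeTwoSixFour_W3136
    ((Summit.BirchSwinnertonDyer.Uniform.U2.HeegnerHeight.canonicalHeight_eq_zero_iff' _).mp h0)

end Height

end Summit.BirchSwinnertonDyer.BirchSwinnertonDyer.Theorems.GoldfeldGoodTwists

end
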